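import Summits.AtomisticToContinuum.Crystallization.Theorems.PalmUnimodularRigidityMinimiserShellsCapDefs
import Summits.AtomisticToContinuum.Crystallization.Theorems.PalmUnimodularRigidityMinimiserShellsMeckePricing
import Summits.AtomisticToContinuum.Crystallization.Theorems.PalmUnimodularRigidityMinimiserShellsPricingToPeriodic
import Summits.AtomisticToContinuum.Crystallization.Theorems.PalmUnimodularRigidityMinimiserShellsSlackCertificates

/-!
# The cap reduction of crux `MinimiserShells` (stmt-AtomisticToContinuum-9225): the crux from TWO named energy
# statements (line `octahedral-annulus-mandate`, lead a1)

Route `PalmUnimodularRigidity`, crux decl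
`Summit.AtomisticToContinuum.Crystallization.Theses.PalmUnimodularRigidity.MinimiserShells`.

This file puts the LOGIC of the checked skeleton `Cruxes/MinimiserShells/Lines/octahedral_annulus_mandate.lean`
(lead reshape r2) into `Theorems/`, so that the two open pieces of the line have stable importable names — in the
spirit of `Residual.ShellGap` (`…ResidualDefs.lean`).  Nothing here is a published fact; the two `def … : Prop` below
are the line's remaining REGISTERED STUBS (objects the route posits), both energy statements of crystallization type
and both OPEN:

* `CapCertificates` (stub `stub_capCertificates`): for every hard core `δ > 0` a cap margin `c > 0` such that for every
  slack `ε > 0` some admissible transfer (`Cap.IsTransfer`) makes `h + div t ≥ e* − ε` at every rooted `δ`-hard-core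
  configuration and `≥ e* + c` at every CAPLESS one (`Cap.Capped`).  Its part (i) (`c = 0`) is PROVED:
  `SlackCertificates.stub_slackCertificates` (read back here as `capCertificates_part_i`).  The open content is the
  cap margin: tetrahedrally-close-packed exclusion at a `4 %·|e*|` margin.
* `CappedRegimeShellGap` (stub `stub_cappedRegimeShellGap`): for every bad-fraction threshold `t > 0` some capless
  tolerance `s > 0` and gap `κ > 0` such that periodic `1/3`-separated configurations with `≥ t·#motif` badly shelled
  and `< s·#motif` capless motif sites have `e(Q) ≥ e* + κ` — `Residual.ShellGap 0` restricted to the close-packed-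
  topology regime (`cappedRegimeShellGap_of_shellGap_zero`); the crux-plan's original form `CappedShellGap`
  (`∀ t ∀ t'`) was equivalent to `ShellGap 0` itself (`cappedShellGap_iff_shellGap_zero`).

Theorems (sorry-free): `capPricing_of_capCertificates` (with the landed Mecke pricing lemma, p130959:
`CapCertificates → CapPricing`, slack-free linear pricing of the capless root event, `ε → 0`);
`capMandate_of_capPricing` (minimising laws are a.s. capped at the root); `capGap_of_capPricing` (with the landed
`PricingToPeriodic`, p130734: the periodic CAP GAP `e(Q) ≥ e* + c·(capless fraction)`);
`shellGap_zero_of_capPricing` (cap gap + capped-regime gap ⇒ `Residual.ShellGap 0`); and the reduction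
`minimiserShells_of_cap : CapCertificates → CappedRegimeShellGap → MinimiserShells` (registered marker `cap_reduction`).
-/

noncomputable section

open MeasureTheory
open scoped ENNReal BigOperators

namespace Summit.AtomisticToContinuum.Crystallization.Theorems.PalmUnimodularRigidityMinimiserShells.Cap

open Literature.Probability.Process (IsPointStationaryLaw IsRootedHardCore)
open Literature.MathematicalPhysics.StatisticalMechanics (lennardJones rootEnergy interactionEnergy PeriodicConfiguration)
open Summit.AtomisticToContinuum.Crystallization.Theses.PalmUnimodularRigidity (MinimiserShells)
open Summit.AtomisticToContinuum.Crystallization.Theorems.MinimiserShells.Negative.LoadBearing (eStar meanRootEnergy)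
open Summit.AtomisticToContinuum.Crystallization.Theorems.MinimiserShells.Negative.Rootedness (E3)
open Summit.AtomisticToContinuum.Crystallization.Theorems.PalmUnimodularRigidityMinimiserShells.Residual
  (ShellGap IsSepThird looseBadMotifCount rerooted minimiserShells_of_shellGap_zero)
open Summit.AtomisticToContinuum.Crystallization.Theorems.MinimiserShells.Negative.UniformRooting
  (rootedMeasure unifRooted rootedMeasure_eq_range isProbabilityMeasure_unifRooted
   isPointStationaryLaw_unifRooted ae_isRootedHardCore_unifRooted meanRootEnergy_unifRooted)
open Summit.AtomisticToContinuum.Crystallization.Theorems.PalmUnimodularRigidityMinimiserShells.PricingContainment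
  (natCard_le_mul_unifRooted_apply)

/-! ## The two open energy statements of the line, and the priced form in between -/

/-- **Cap certificates** (registered stub `stub_capCertificates` of line `octahedral-annulus-mandate`; OPEN in its part
(ii), the cap margin `c > 0`).  For every hard core `δ > 0` there is `c > 0` such that for every slack `ε > 0` some
admissible transfer `t` (jointly measurable, bounded, finite range) makes the transferred root energy `h + div t` at
least `e* − ε` at EVERY rooted `δ`-hard-core configuration and at least `e* + c` at every CAPLESS one. -/
def CapCertificates : Prop :=
  ∀ δ : ℝ, 0 < δ → ∃ c : ℝ, 0 < c ∧ ∀ ε : ℝ, 0 < ε →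
    ∃ R M : ℝ, ∃ t : Measure E3 → E3 → ℝ, IsTransfer R M t ∧
      ∀ μ : Measure E3, IsRootedHardCore δ μ →
        eStar - ε ≤ rootEnergy lennardJones μ + transferDiv t μ ∧
        (¬ Capped μ → eStar + c ≤ rootEnergy lennardJones μ + transferDiv t μ)

/-- **Cap pricing** (the measure-level form): for every hard core `δ > 0` some `c > 0` prices the capless root event
linearly, `e* + c·P{root capless} ≤ E_P[h]`, over all point-stationary almost surely `δ`-hard-core probability laws. -/
def CapPricing : Prop :=
  ∀ δ : ℝ, 0 < δ → ∃ c : ℝ, 0 < c ∧ ∀ P : Measure (Measure E3), IsProbabilityMeasure P →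
    (∀ᵐ μ ∂P, IsRootedHardCore δ μ) → IsPointStationaryLaw P →
    eStar + c * (P {μ | ¬ Capped μ}).toReal ≤ meanRootEnergy P

/-- **Capped-regime shell gap** (registered stub `stub_cappedRegimeShellGap`, lead reshape r2; OPEN, crux-class): for
every `t > 0` there are a capless tolerance `s > 0` and `κ > 0` such that every periodic configuration with
`1/3`-separated points, `≥ t·#motif` badly shelled motif sites (`looseBadMotifCount 0`) and `< s·#motif` capless ones
(`caplessMotifCount`) has `e* + κ ≤ e(Q)`. -/
def CappedRegimeShellGap : Prop :=
  ∀ t : ℝ, 0 < t → ∃ s : ℝ, 0 < s ∧ ∃ κ : ℝ, 0 < κ ∧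
    ∀ Q : PeriodicConfiguration 3, IsSepThird Q →
      t * (Q.motif.card : ℝ) ≤ (looseBadMotifCount 0 Q : ℝ) →
      (caplessMotifCount Q : ℝ) < s * (Q.motif.card : ℝ) →
      eStar + κ ≤ Q.energyPerParticle lennardJones

/-- The crux-plan's ORIGINAL residual stub (`stub_cappedShellGap`, `∀ t ∀ t' ∃ κ`), kept for the record: it is
equivalent to `Residual.ShellGap 0` (`cappedShellGap_iff_shellGap_zero`). -/
def CappedShellGap : Prop :=
  ∀ t : ℝ, 0 < t → ∀ t' : ℝ, 0 < t' → ∃ κ : ℝ, 0 < κ ∧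
    ∀ Q : PeriodicConfiguration 3, IsSepThird Q →
      t * (Q.motif.card : ℝ) ≤ (looseBadMotifCount 0 Q : ℝ) →
      (caplessMotifCount Q : ℝ) < t' * (Q.motif.card : ℝ) →
      eStar + κ ≤ Q.energyPerParticle lennardJones

/-! ## Part (i) of the cap certificates is proved -/

/-- **Part (i) of `CapCertificates` holds** (the slack-`ε` universal certificate, cap margin `c = 0`):
`SlackCertificates.stub_slackCertificates` (p131413, constructive from the random-grid transport of the energy
floor), folded into the line's vocabulary. -/
theorem capCertificates_part_i :
    ∀ δ : ℝ, 0 < δ → ∀ ε : ℝ, 0 < ε →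
      ∃ R M : ℝ, ∃ t : Measure E3 → E3 → ℝ, IsTransfer R M t ∧
        ∀ μ : Measure E3, IsRootedHardCore δ μ →
          eStar - ε ≤ rootEnergy lennardJones μ + transferDiv t μ :=
  SlackCertificates.stub_slackCertificates

/-! ## From certificates to pricing, mandate and cap gap -/

/-- **`CapCertificates → CapPricing`** (`ε → 0` through the landed Mecke pricing lemma
`MeckePricing.stub_meckePricing_unfolded`, p130959). -/
theorem capPricing_of_capCertificates (h1 : CapCertificates) : CapPricing := by
  intro δ hδ
  obtain ⟨c, hc, hcert⟩ := h1 δ hδ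
  refine ⟨c, hc, fun P hP hcore hstat => ?_⟩
  refine le_of_forall_pos_le_add fun ε hε => ?_
  obtain ⟨R, M, t, ht, hpt⟩ := hcert ε hε
  have hp0 : 0 ≤ (P {μ | ¬ Capped μ}).toReal := ENNReal.toReal_nonneg
  have key : eStar - ε + (c + ε) * (P {μ | ¬ Capped μ}).toReal ≤ meanRootEnergy P :=
    MeckePricing.stub_meckePricing_unfolded δ hδ P hP hcore hstat R M t ht Capped (eStar - ε) (c + ε)
      (by linarith) (fun μ hμ => ⟨(hpt μ hμ).1, fun hG => by
        have h' := (hpt μ hμ).2 hG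
        unfold transferDiv at h'
        linarith⟩)
  have hεp : 0 ≤ ε * (P {μ | ¬ Capped μ}).toReal := mul_nonneg hε.le hp0
  nlinarith [key, hεp]

/-- **The cap mandate**: under `CapPricing`, minimising point-stationary hard-core laws are almost surely CAPPED at
the root (`c·P(capless) ≤ E_P[h] − e* ≤ 0`; outer-measure bookkeeping, no measurability of `Capped` needed). -/
theorem capMandate_of_capPricing (h : CapPricing) :
    ∀ δ : ℝ, 0 < δ → ∀ P : Measure (Measure E3), IsProbabilityMeasure P →
      (∀ᵐ μ ∂P, IsRootedHardCore δ μ) → IsPointStationaryLaw P → meanRootEnergy P ≤ eStar →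
      ∀ᵐ μ ∂P, Capped μ := by
  intro δ hδ P hP hcore hstat hE
  obtain ⟨c, hc, hprice⟩ := h δ hδ
  have hineq := hprice P hP hcore hstat
  have h1' : c * (P {μ | ¬ Capped μ}).toReal ≤ 0 := by linarith
  have h2' : 0 ≤ (P {μ | ¬ Capped μ}).toReal := ENNReal.toReal_nonneg
  have hzero : (P {μ | ¬ Capped μ}).toReal = 0 := by nlinarith
  rw [ae_iff]
  rcases (ENNReal.toReal_eq_zero_iff _).1 hzero with h0 | htop
  · exact h0
  · exact absurd htop (measure_ne_top P _)

/-- **The periodic CAP GAP with a linear constant**: under `CapPricing`, every periodic configuration with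
`1/3`-separated points and at least `t·#motif` capless motif sites has `e(Q) ≥ e* + c·t` (the landed
`PricingToPeriodic.stub_pricingToPeriodic`, p130734, at the radius-2-local predicate `Capped`, `Cap.capped_local`). -/
theorem capGap_of_capPricing (h : CapPricing) :
    ∃ c : ℝ, 0 < c ∧ ∀ Q : PeriodicConfiguration 3, IsSepThird Q → ∀ t : ℝ,
      t * (Q.motif.card : ℝ) ≤ (caplessMotifCount Q : ℝ) →
      eStar + c * t ≤ Q.energyPerParticle lennardJones := by
  obtain ⟨c, hc, hprice⟩ := h (1 / 3) (by norm_num)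
  exact ⟨c, hc, fun Q hQ t ht =>
    PricingToPeriodic.stub_pricingToPeriodic Capped capped_local c hc hprice Q hQ t ht⟩

/-! ## The residual: the crux-plan's form was `ShellGap 0`; the reshaped form is its capped-regime piece -/

/-- The capless count never exceeds the motif size. -/
theorem caplessMotifCount_le (Q : PeriodicConfiguration 3) : caplessMotifCount Q ≤ Q.motif.card := by
  unfold caplessMotifCount
  calc Nat.card {x : Q.motif // ¬ Capped (rerooted Q (x : E3))} ≤ Nat.card Q.motif := Finite.card_subtype_le _
    _ = Q.motif.card := by rw [Nat.card_eq_fintype_card, Fintype.card_coe]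

/-- **The crux-plan's residual stub WAS the full residual**: `CappedShellGap ↔ Residual.ShellGap 0` (at `t' = 2` the
capless hypothesis always holds). -/
theorem cappedShellGap_iff_shellGap_zero : CappedShellGap ↔ ShellGap 0 := by
  constructor
  · intro h t ht
    obtain ⟨κ, hκ, hgap⟩ := h t ht 2 two_pos
    refine ⟨κ, hκ, fun Q hsep hbad => hgap Q hsep hbad ?_⟩
    have h1 : (caplessMotifCount Q : ℝ) ≤ (Q.motif.card : ℝ) := by exact_mod_cast caplessMotifCount_le Q
    have h2 : (0 : ℝ) < Q.motif.card := by exact_mod_cast Q.motif_nonempty.card_pos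
    linarith
  · intro h t ht _ _
    obtain ⟨κ, hκ, hgap⟩ := h t ht
    exact ⟨κ, hκ, fun Q hsep hbad _ => hgap Q hsep hbad⟩

/-- **`Residual.ShellGap 0 → CappedRegimeShellGap`** (any tolerance works): the reshaped residual is a piece of the
certified-open residual of the crux. -/
theorem cappedRegimeShellGap_of_shellGap_zero (h : ShellGap 0) : CappedRegimeShellGap := by
  intro t ht
  obtain ⟨κ, hκ, hgap⟩ := h t ht
  exact ⟨1, one_pos, κ, hκ, fun Q hsep hbad _ => hgap Q hsep hbad⟩

/-- **Gluing the regimes**: cap pricing (TCP regime, through the cap gap) and the capped-regime gap give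
`Residual.ShellGap 0` (case split on the capless fraction at the tolerance `s(t)`; `κ' = min (c·s) κ`). -/
theorem shellGap_zero_of_capPricing (h : CapPricing) (h4 : CappedRegimeShellGap) : ShellGap 0 := by
  obtain ⟨c, hc, hgap⟩ := capGap_of_capPricing h
  intro t ht
  obtain ⟨s, hs, κ, hκ, hres⟩ := h4 t ht
  refine ⟨min (c * s) κ, lt_min (mul_pos hc hs) hκ, fun Q hsep hbad => ?_⟩
  by_cases hcase : s * (Q.motif.card : ℝ) ≤ (caplessMotifCount Q : ℝ)
  · have h' := hgap Q hsep s hcase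
    have hmin := min_le_left (c * s) κ
    linarith
  · push Not at hcase
    have h' := hres Q hsep hbad hcase
    have hmin := min_le_right (c * s) κ
    linarith

/-- So MODULO `CapPricing` the reshaped residual is equivalent to `Residual.ShellGap 0`. -/
theorem cappedRegimeShellGap_iff_shellGap_zero_of_capPricing (h : CapPricing) :
    CappedRegimeShellGap ↔ ShellGap 0 :=
  ⟨shellGap_zero_of_capPricing h, cappedRegimeShellGap_of_shellGap_zero⟩

/-! ## The finite form of cap pricing (necessity): a linear FINITE CAP INEQUALITY -/

/-- **Cap pricing is, on finite clusters, a LINEAR cap inequality** (necessity, by exact uniform rooting): if `c > 0`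
prices the capless root event over point-stationary a.s. `δ`-hard-core probability laws, then every finite injective
`δ`-separated configuration `y : Fin N → ℝ³` satisfies `N·e* + c·#{i capless in y} ≤ 𝓔_N(y)` (caplessness read in the
cluster re-rooted at `y i`, `count|((· − y i) '' range y)`).  Proof: the uniformly rooted law `P_y` is exactly
point-stationary with `E_{P_y}[h] = 𝓔_N(y)/N` (`Negative.UniformRooting`) and charges the capless event with mass
`≥ #capless/N` (`PricingContainment.natCard_le_mul_unifRooted_apply`).  So the pricing constant of `CapPricing` (hence of
`CapCertificates`) is at most `inf (𝓔_N(y) − N e*)/#capless(y)` over finite clusters — the finite CEILING a refuter or a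
certificate designer works against; the converse (sufficiency of the finite inequality for the certificates, by the
random-grid transport with a per-cell surcharge) is the natural finite target for part (ii) of stub 1. -/
theorem finite_cap_inequality_of_pricing {δ c : ℝ}
    (hprice : ∀ P : Measure (Measure E3), IsProbabilityMeasure P →
      (∀ᵐ μ ∂P, IsRootedHardCore δ μ) → IsPointStationaryLaw P →
      eStar + c * (P {μ | ¬ Capped μ}).toReal ≤ meanRootEnergy P)
    (hc : 0 ≤ c) {N : ℕ} (y : Fin N → E3) (hy : Function.Injective y)
    (hsep : ∀ i j : Fin N, i ≠ j → δ ≤ dist (y i) (y j)) :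
    (N : ℝ) * eStar + c * (Nat.card {i : Fin N //
        ¬ Capped ((Measure.count : Measure E3).restrict ((fun z => z - y i) '' Set.range y))} : ℝ) ≤
      interactionEnergy lennardJones y := by
  rcases Nat.eq_zero_or_pos N with hN | hN
  · subst hN
    have h0 : Nat.card {i : Fin 0 //
        ¬ Capped ((Measure.count : Measure E3).restrict ((fun z => z - y i) '' Set.range y))} = 0 :=
      Nat.card_of_isEmpty
    have hE : interactionEnergy lennardJones y = 0 := by
      unfold interactionEnergy; simp
    rw [h0, hE]
    simp
  · haveI : NeZero N := ⟨hN.ne'⟩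
    have hNr : (0 : ℝ) < N := by exact_mod_cast hN
    have hP : IsProbabilityMeasure (unifRooted y) := isProbabilityMeasure_unifRooted y
    have hcore : ∀ᵐ μ ∂(unifRooted y), IsRootedHardCore δ μ := ae_isRootedHardCore_unifRooted hsep
    have hstat : IsPointStationaryLaw (unifRooted y) := isPointStationaryLaw_unifRooted hy
    have hineq := hprice _ hP hcore hstat
    rw [meanRootEnergy_unifRooted hy] at hineq
    -- the capless count is charged by `P_y`
    have h1 := natCard_le_mul_unifRooted_apply y {μ | ¬ Capped μ}
    have h2 : Nat.card {i : Fin N //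
          ¬ Capped ((Measure.count : Measure E3).restrict ((fun z => z - y i) '' Set.range y))} =
        Nat.card {i : Fin N // rootedMeasure y i ∈ {μ | ¬ Capped μ}} := by
      refine Nat.card_congr (Equiv.subtypeEquivRight fun i => ?_)
      have hset : (fun z => z - y i) '' Set.range y = Set.range fun k => y k - y i := by
        ext w
        simp only [Set.mem_image, Set.mem_range, exists_exists_eq_and]
      rw [Set.mem_setOf_eq, rootedMeasure_eq_range, hset]
    rw [h2]
    have h3 : c * (Nat.card {i : Fin N // rootedMeasure y i ∈ {μ | ¬ Capped μ}} : ℝ) ≤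
        c * ((N : ℝ) * ((unifRooted y) {μ | ¬ Capped μ}).toReal) := mul_le_mul_of_nonneg_left h1 hc
    have h4 : (N : ℝ) * (eStar + c * ((unifRooted y) {μ | ¬ Capped μ}).toReal) ≤
        interactionEnergy lennardJones y := by
      rw [← le_div_iff₀' hNr]
      exact hineq
    nlinarith [h3, h4]

/-- **`CapPricing` in finite form**: for every hard core `δ > 0` some `c > 0` makes every finite injective `δ`-separated
cluster satisfy the linear cap inequality `N·e* + c·#capless ≤ 𝓔_N`. -/
theorem finite_cap_inequality_of_capPricing (h : CapPricing) :
    ∀ δ : ℝ, 0 < δ → ∃ c : ℝ, 0 < c ∧ ∀ (N : ℕ) (y : Fin N → E3), Function.Injective y →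
      (∀ i j : Fin N, i ≠ j → δ ≤ dist (y i) (y j)) →
      (N : ℝ) * eStar + c * (Nat.card {i : Fin N //
          ¬ Capped ((Measure.count : Measure E3).restrict ((fun z => z - y i) '' Set.range y))} : ℝ) ≤
        interactionEnergy lennardJones y := by
  intro δ hδ
  obtain ⟨c, hc, hprice⟩ := h δ hδ
  exact ⟨c, hc, fun N y hy hsep => finite_cap_inequality_of_pricing hprice hc.le y hy hsep⟩

/-! ## The reduction of the crux -/

/-- **`CapPricing → CappedRegimeShellGap → MinimiserShells`** (through `Residual.ShellGap 0` and the landed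
sufficiency `Residual.minimiserShells_of_shellGap_zero`, p121752). -/
theorem minimiserShells_of_capPricing (h : CapPricing) (h4 : CappedRegimeShellGap) : MinimiserShells :=
  minimiserShells_of_shellGap_zero (shellGap_zero_of_capPricing h h4)

/-- **The cap reduction** (registered marker `cap_reduction`): the crux `MinimiserShells` follows from the line's two
remaining stubs, `CapCertificates` (open: the cap margin) and `CappedRegimeShellGap` (open: capped-regime
crystallization) — the sorry-free logic of the checked skeleton `Lines/octahedral_annulus_mandate.lean` with its two
landed stubs (Mecke pricing p130959, pricing-to-periodic p130734) discharged. -/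
theorem cap_reduction : CapCertificates → CappedRegimeShellGap → MinimiserShells :=
  fun h1 h4 => minimiserShells_of_capPricing (capPricing_of_capCertificates h1) h4

end Summit.AtomisticToContinuum.Crystallization.Theorems.PalmUnimodularRigidityMinimiserShells.Cap

end
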